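import Summits.BirchSwinnertonDyer.BirchSwinnertonDyer.Theorems.ThetaPartnerAtTwoSignedKatoUpToAtTwoPointsLocalCover
import Summits.BirchSwinnertonDyer.BirchSwinnertonDyer.Theorems.ThetaPartnerAtTwoSignedKatoUpToAtTwoKummerEquivariant
import Literature.NumberTheory.EllipticCurves.IwasawaAlgebraInvolution
import HarnessLib

/-!
# Route `ThetaPartnerAtTwo` (TP2), crux K3 `SignedKatoDivisibilityUpToAtTwo` (item stmt-BirchSwinnertonDyer-20308),
# line `colemanrat` v5 — **the points-model `j` is `ι`-SEMILINEAR for Sprung's twist**: for a functional `z` on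
# `E(ℚ_∞·ℚ_v)` and its twist `w = z ∘ σ⁻¹` (`σ` a local lift of the generator `γ`, the direction in which Sprung's
# Coleman map is `Λ`-linear: `Col(w − z) = T·Col(z)`), the width seat's points-model `j` satisfies
# `(1 + T) • j(w|_A) = j(z|_A)` and `j(w|_A) − j(z|_A) = ι(T) • j(z|_A)`, `ι = IwasawaAlgebra.invol p` (`ι(T) = (1+T)⁻¹ − 1`) —
# the semilinearity clause `j (g • y) = ι(g) • j y` of the registered stub `stub_localRobustPackageTwoInv` (R2^ι) on the generator `T`.

Lead `bsd-wall-tp2-p2x` g4 (cell `bsd-wall`). HONEST FRAMING: THEOREMS ONLY — no definition, no named fact, no instance, no `sorry`;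
closes no item; BSD is NOT proved by any of this. Inputs: w3's `KummerPoint.toDual_X_smul_pointsModelJ` (`X • j φ = j(φ ∘ σ) − j φ`),
w2's `IwasawaAlgebra.invol` (`invol_X`, `invol_one_add_X`, `one_add_X_mul_invol_one_add_X`). Companion of `…PointsTwistConvention`
(Coleman side: `Col(z ∘ σ⁻¹ − z) = T·Col z`, `Sprung2012.IsColemanPair.twist_sub`).

## What is proved
* `pointsModelJ_X_smul_eq` — element form of w3's lemma: `X • j φ = j (φ ∘ σ) − j φ` in `D.X` (`D.toDual` injective).
* `one_add_X_smul_pointsModelJ_twist` — `(1 + T) • j(w|_A) = j(z|_A)` for `w = z ∘ σ⁻¹`.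
* `pointsModelJ_twist_sub` — **`j(w|_A) − j(z|_A) = ι(T) • j(z|_A)`**: the `T`-instance of the semilinearity of `j`.

References: [Kobayashi2003] §8.5 (p. 18); [Sprung2012] §2 p. 1486, Def. 3.1, Def. 5.9; [GreenbergLNM1716] §1 p. 60;
[MazurTateTeitelbaum1986Invent] Ch. I §17.
-/

set_option autoImplicit false
-- the Theorems namespace of this sub repeats the summit name by design (D-0017 nested layout)
set_option linter.dupNamespace false

noncomputable section

open scoped Classical

namespace Summit.BirchSwinnertonDyer.BirchSwinnertonDyer.Theorems

namespace SignedKatoOffTwo.KummerPoint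

open NumberField IsDedekindDomain Field WeierstrassCurve
  Literature.NumberTheory.EllipticCurves Literature.NumberTheory.EllipticCurves.Kobayashi2003
  Literature.NumberTheory.EllipticCurves.Sprung2012 Literature.NumberTheory.GaloisRepresentations ZpExtension

universe u

section Rat

variable (W : WeierstrassCurve ℚ) {p : ℕ} [Fact p.Prime] (κ : ZpExtension ℚ p) {γ : absoluteGaloisGroup ℚ} (ε : ℤˣ)

/-- **Element form of `toDual_X_smul_pointsModelJ`**: `X • j φ_A = j (φ_A ∘ σ) − j φ_A` in `D.X` (`D.toDual` is injective).
[cite: Kobayashi2003, §8.5 (p. 18)] [cite: Sprung2012, Def. 3.1 and Def. 5.9] -/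
theorem pointsModelJ_X_smul_eq (v : HeightOneSpectrum (𝓞 ℚ)) (hv : (p : 𝓞 ℚ) ∈ v.asIdeal)
    (σ : absoluteGaloisGroup (v.adicCompletion ℚ)) (hσ : κ γ = κ (resGalOfEmb (closureEmb (K := ℚ) (v.adicCompletion ℚ)) σ))
    (hA : ∀ a ∈ (⨆ n, signedLocalPoints κ (v.adicCompletion ℚ) W ε n), σ • a ∈ (⨆ n, signedLocalPoints κ (v.adicCompletion ℚ) W ε n))
    (D : SignedSelmerDualData W κ γ ε)
    (j : (↥(⨆ n, signedLocalPoints κ (v.adicCompletion ℚ) W ε n) →+ ℤ_[p]) →+ D.X)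
    (hj : ∀ (φA : ↥(⨆ n, signedLocalPoints κ (v.adicCompletion ℚ) W ε n) →+ ℤ_[p])
        (s : W.subgroupH1 p κ.kerSubgroup) (hs : s ∈ signedSelmerInfty W κ ε)
        (φ : contOneCocycles (discreteTopRep κ.kerSubgroup (W.geomPrimaryTorsion p)))
        (Q : localPoints W (v.adicCompletion ℚ)) (k : ℕ)
        (_ : oneCocycleClass _ φ = s) (hQ : p ^ k • Q ∈ (⨆ n, signedLocalPoints κ (v.adicCompletion ℚ) W ε n))
        (_ : ∀ τ : localSubgroupOfEmb κ.kerSubgroup (closureEmb (K := ℚ) (v.adicCompletion ℚ)),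
          pointsMapOfEmb W (closureEmb (K := ℚ) (v.adicCompletion ℚ))
              ((φ.1 (resGalSubgroupOfEmb κ.kerSubgroup _ τ) : W.geomPrimaryTorsion p) : W.geomPoints) =
            (τ : absoluteGaloisGroup (v.adicCompletion ℚ)) • Q - Q),
        D.toDual (j φA) ⟨s, hs⟩ =
          (PadicInt.toZModPow k (φA ⟨p ^ k • Q, hQ⟩)).val • ((((p : ℚ) ^ k)⁻¹ : ℚ) : AddCircle (1 : ℚ)))
    (φA : ↥(⨆ n, signedLocalPoints κ (v.adicCompletion ℚ) W ε n) →+ ℤ_[p]) :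
    (PowerSeries.X : IwasawaAlgebra p) • j φA =
      j (φA.comp (((DistribSMul.toAddMonoidHom (localPoints W (v.adicCompletion ℚ)) σ).comp
        (⨆ n, signedLocalPoints κ (v.adicCompletion ℚ) W ε n).subtype).codRestrict
          (⨆ n, signedLocalPoints κ (v.adicCompletion ℚ) W ε n) (fun a ↦ hA a a.2))) - j φA := by
  apply D.bijective.1
  ext ⟨s, hs⟩
  rw [map_sub, AddMonoidHom.sub_apply]
  exact toDual_X_smul_pointsModelJ W κ ε v hv σ hσ hA D j hj φA s hs

/-- **`(1 + T) • j(w|_A) = j(z|_A)` for the twist `w = z ∘ σ⁻¹`** (`w(y) = z(σ⁻¹ y)`, the direction of Sprung's `Θ_σ`, in which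
`Col(w − z) = T·Col(z)`): `(w|_A) ∘ σ = z|_A`, so `X • j(w|_A) = j(z|_A) − j(w|_A)`. [cite: Kobayashi2003, §8.5 (p. 18)]
[cite: Sprung2012, §2 p. 1486, Def. 3.1] -/
theorem one_add_X_smul_pointsModelJ_twist (v : HeightOneSpectrum (𝓞 ℚ)) (hv : (p : 𝓞 ℚ) ∈ v.asIdeal)
    (σ : absoluteGaloisGroup (v.adicCompletion ℚ)) (hσ : κ γ = κ (resGalOfEmb (closureEmb (K := ℚ) (v.adicCompletion ℚ)) σ))
    (hA : ∀ a ∈ (⨆ n, signedLocalPoints κ (v.adicCompletion ℚ) W ε n), σ • a ∈ (⨆ n, signedLocalPoints κ (v.adicCompletion ℚ) W ε n))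
    (D : SignedSelmerDualData W κ γ ε)
    (j : (↥(⨆ n, signedLocalPoints κ (v.adicCompletion ℚ) W ε n) →+ ℤ_[p]) →+ D.X)
    (hj : ∀ (φA : ↥(⨆ n, signedLocalPoints κ (v.adicCompletion ℚ) W ε n) →+ ℤ_[p])
        (s : W.subgroupH1 p κ.kerSubgroup) (hs : s ∈ signedSelmerInfty W κ ε)
        (φ : contOneCocycles (discreteTopRep κ.kerSubgroup (W.geomPrimaryTorsion p)))
        (Q : localPoints W (v.adicCompletion ℚ)) (k : ℕ)
        (_ : oneCocycleClass _ φ = s) (hQ : p ^ k • Q ∈ (⨆ n, signedLocalPoints κ (v.adicCompletion ℚ) W ε n))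
        (_ : ∀ τ : localSubgroupOfEmb κ.kerSubgroup (closureEmb (K := ℚ) (v.adicCompletion ℚ)),
          pointsMapOfEmb W (closureEmb (K := ℚ) (v.adicCompletion ℚ))
              ((φ.1 (resGalSubgroupOfEmb κ.kerSubgroup _ τ) : W.geomPrimaryTorsion p) : W.geomPoints) =
            (τ : absoluteGaloisGroup (v.adicCompletion ℚ)) • Q - Q),
        D.toDual (j φA) ⟨s, hs⟩ =
          (PadicInt.toZModPow k (φA ⟨p ^ k • Q, hQ⟩)).val • ((((p : ℚ) ^ k)⁻¹ : ℚ) : AddCircle (1 : ℚ)))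
    (hle : (⨆ n, signedLocalPoints κ (v.adicCompletion ℚ) W ε n) ≤ localTowerPointsOfEmb κ (closureEmb (K := ℚ) (v.adicCompletion ℚ)) W)
    {z w : localTowerPointsOfEmb κ (closureEmb (K := ℚ) (v.adicCompletion ℚ)) W →+ ℤ_[p]}
    (hw : ∀ y : localTowerPointsOfEmb κ (closureEmb (K := ℚ) (v.adicCompletion ℚ)) W,
      w y = z ⟨σ⁻¹ • (y : localPoints W (v.adicCompletion ℚ)), smul_mem_localTowerPointsOfEmb κ _ W σ⁻¹ y.2⟩) :
    (1 + (PowerSeries.X : IwasawaAlgebra p)) • j (w.comp (AddSubgroup.inclusion hle)) = j (z.comp (AddSubgroup.inclusion hle)) := by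
  have hX := pointsModelJ_X_smul_eq W κ ε v hv σ hσ hA D j hj (w.comp (AddSubgroup.inclusion hle))
  -- `(w|_A) ∘ σ = z|_A`
  have hfun : (w.comp (AddSubgroup.inclusion hle)).comp
      (((DistribSMul.toAddMonoidHom (localPoints W (v.adicCompletion ℚ)) σ).comp
        (⨆ n, signedLocalPoints κ (v.adicCompletion ℚ) W ε n).subtype).codRestrict
          (⨆ n, signedLocalPoints κ (v.adicCompletion ℚ) W ε n) (fun a ↦ hA a a.2)) =
      z.comp (AddSubgroup.inclusion hle) := by
    ext a
    change w ⟨σ • (a : localPoints W (v.adicCompletion ℚ)), _⟩ = z ⟨(a : localPoints W (v.adicCompletion ℚ)), _⟩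
    rw [hw]
    congr 1
    apply Subtype.ext
    change σ⁻¹ • σ • (a : localPoints W (v.adicCompletion ℚ)) = (a : localPoints W (v.adicCompletion ℚ))
    rw [inv_smul_smul]
  rw [hfun] at hX
  rw [add_smul, one_smul, hX, add_sub_cancel]

/-- **The `T`-instance of the `ι`-semilinearity of `j`**: `j(w|_A) − j(z|_A) = ι(T) • j(z|_A)` for `w = z ∘ σ⁻¹`, `ι = IwasawaAlgebra.invol p`
(`ι(T) = (1+T)⁻¹ − 1`; multiply `(1 + T) • j(w|_A) = j(z|_A)` by `ι(1 + T) = (1+T)⁻¹`). With `Col(w − z) = T·Col(z)`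
(`Sprung2012.IsColemanPair.twist_sub`) this is the clause `j (T • y) = ι(T) • j y` of the registered stub (R2^ι) for `y = [z]`.
[cite: GreenbergLNM1716, §1 p. 60] [cite: MazurTateTeitelbaum1986Invent, Ch. I §17] [cite: Sprung2012, Def. 5.9 (p. 1495)] -/
theorem pointsModelJ_twist_sub (v : HeightOneSpectrum (𝓞 ℚ)) (hv : (p : 𝓞 ℚ) ∈ v.asIdeal)
    (σ : absoluteGaloisGroup (v.adicCompletion ℚ)) (hσ : κ γ = κ (resGalOfEmb (closureEmb (K := ℚ) (v.adicCompletion ℚ)) σ))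
    (hA : ∀ a ∈ (⨆ n, signedLocalPoints κ (v.adicCompletion ℚ) W ε n), σ • a ∈ (⨆ n, signedLocalPoints κ (v.adicCompletion ℚ) W ε n))
    (D : SignedSelmerDualData W κ γ ε)
    (j : (↥(⨆ n, signedLocalPoints κ (v.adicCompletion ℚ) W ε n) →+ ℤ_[p]) →+ D.X)
    (hj : ∀ (φA : ↥(⨆ n, signedLocalPoints κ (v.adicCompletion ℚ) W ε n) →+ ℤ_[p])
        (s : W.subgroupH1 p κ.kerSubgroup) (hs : s ∈ signedSelmerInfty W κ ε)
        (φ : contOneCocycles (discreteTopRep κ.kerSubgroup (W.geomPrimaryTorsion p)))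
        (Q : localPoints W (v.adicCompletion ℚ)) (k : ℕ)
        (_ : oneCocycleClass _ φ = s) (hQ : p ^ k • Q ∈ (⨆ n, signedLocalPoints κ (v.adicCompletion ℚ) W ε n))
        (_ : ∀ τ : localSubgroupOfEmb κ.kerSubgroup (closureEmb (K := ℚ) (v.adicCompletion ℚ)),
          pointsMapOfEmb W (closureEmb (K := ℚ) (v.adicCompletion ℚ))
              ((φ.1 (resGalSubgroupOfEmb κ.kerSubgroup _ τ) : W.geomPrimaryTorsion p) : W.geomPoints) =
            (τ : absoluteGaloisGroup (v.adicCompletion ℚ)) • Q - Q),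
        D.toDual (j φA) ⟨s, hs⟩ =
          (PadicInt.toZModPow k (φA ⟨p ^ k • Q, hQ⟩)).val • ((((p : ℚ) ^ k)⁻¹ : ℚ) : AddCircle (1 : ℚ)))
    (hle : (⨆ n, signedLocalPoints κ (v.adicCompletion ℚ) W ε n) ≤ localTowerPointsOfEmb κ (closureEmb (K := ℚ) (v.adicCompletion ℚ)) W)
    {z w : localTowerPointsOfEmb κ (closureEmb (K := ℚ) (v.adicCompletion ℚ)) W →+ ℤ_[p]}
    (hw : ∀ y : localTowerPointsOfEmb κ (closureEmb (K := ℚ) (v.adicCompletion ℚ)) W,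
      w y = z ⟨σ⁻¹ • (y : localPoints W (v.adicCompletion ℚ)), smul_mem_localTowerPointsOfEmb κ _ W σ⁻¹ y.2⟩) :
    j (w.comp (AddSubgroup.inclusion hle)) - j (z.comp (AddSubgroup.inclusion hle)) =
      IwasawaAlgebra.invol p PowerSeries.X • j (z.comp (AddSubgroup.inclusion hle)) := by
  have h1 := one_add_X_smul_pointsModelJ_twist W κ ε v hv σ hσ hA D j hj hle hw
  -- multiply by `ι(1+T) = (1+T)⁻¹`
  have h2 : j (w.comp (AddSubgroup.inclusion hle)) =
      IwasawaAlgebra.invol p (1 + PowerSeries.X) • j (z.comp (AddSubgroup.inclusion hle)) := by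
    rw [← h1, ← mul_smul, mul_comm, IwasawaAlgebra.one_add_X_mul_invol_one_add_X, one_smul]
  rw [h2, IwasawaAlgebra.invol_one_add_X, IwasawaAlgebra.invol_X, add_smul, one_smul, add_sub_cancel_left]

end Rat

end SignedKatoOffTwo.KummerPoint

end Summit.BirchSwinnertonDyer.BirchSwinnertonDyer.Theorems

end
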